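import Summits.CriticalPhenomena.PercolationContinuityZ3.Theorems.PercNearOneGluingNoHeavyConstsChainRuleBernsteinCexTable
import Summits.CriticalPhenomena.PercolationContinuityZ3.Theorems.PercNearOneGluingNoHeavyConstsDominatedChainRule
import Summits.CriticalPhenomena.PercolationContinuityZ3.Theorems.PercNearOneGluingNoHeavyConstsSingleEdgeChainRuleOfSEE
import Summits.CriticalPhenomena.PercolationContinuityZ3.Theorems.PercNearOneGluingNoHeavyConstsSingleEdgeExtremalBernstein
import HarnessLib
import HarnessLib.Audit.Tags

/-!
# REFUTATION of `Consts.SingleEdgeChainRule` (the single-edge chain rule): an exact seven-vertex counterexample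
# (PAPER-2 track (ii): constants of the CSH family)

builds on p205010 (kernel theorem, internal audit signed; external expert review pending).  Support file (`--supports
stmt-CriticalPhenomena-4575`), seat `prim-consts-2` (gen 8); memo `run/shared/lean/prim/consts/FROM-prim-consts-2-g8-STAR-PEEL.md` §8,
evidence `consts/CEX-SingleEdgeChainRule-g8.md`.  The witness was found by the constants census cell (ttrl3 relay 119, 2026-08-22, exact
Bernstein-subdivision minimisation) and, in an 8-vertex form, by this seat; every number below is an exact rational decided by the KERNEL
(`decide +kernel`; no `native_decide`).  No definitions of mathematical content (only Boolean event predicates on the listed configurations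
and a cheap mass function), no named facts, no sorries.

`Consts.SingleEdgeChainRule` (seat prim-consts-2 gen 3, p249755, `@[conjecture]`): for all finite weighted graphs and `x,u,v,o,Y`,
`μ(N₁)·(μ(A₃)μ(R₂) − μ(A₂)μ(R₃)) ≤ μ(N₂)·(μ(A₃)μ(R₁) − μ(A₁)μ(R₃))`.  **It is FALSE.**  WITNESS (the graph of the BERN counterexample
`Consts.BernCex.D`, p311209, with tuned weights): `n = 7`, pairs `(0,1),(0,4),(0,5),(0,6),(1,2),(1,5),(2,3),(2,5),(3,4)` with weights
`127/128, 1/4, 1/2, 191/192, 255/256, 63/64, 191/192, 1/8, 255/256` (every other pair `0`), `x = 6, u = 4, v = 3, o = 2, Y = {1}`: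
`μ(R₁) = 431445304589/52776558133248`, `μ(R₂) = 13803815763/140737488355328`, `μ(R₃) = 111623239/1649267441664`,
`μ(A₁) = 178315117/52776558133248`, `μ(A₂) = 3756037715/140737488355328`, `μ(A₃) = 44188487/1649267441664`,
`μ(N₁) = 10343936753087/1266637395197952`, `μ(N₂) = 4315824213/140737488355328`, and
`RHS − LHS = −18640298111694042707/1148452988358167314188889300082217713664 < 0`.
METHOD: the kernel-arithmetic bridge `FK.RCEval` (`…LowerTailFKExactEval.lean`) at cluster weight `q = 1` (`rcMeasureW w 1 ∅ = prodBernoulli w`)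
turns each measure into a sum over the `2⁹` configurations of the listed pairs; the eight events are read off the kernel-checked LEVEL TABLE of
`…ChainRuleBernsteinCexTable.lean` (`BernCex.table_spec`: for every configuration the number of sources `x ⊂ xu ⊂ xuv` separated from
`Y∪v`, `Y`, `Y∪o`), so that the `512`-term sums only involve table look-ups and products of nine rationals.
WHY THE CENSUSES MISSED IT (memo §8): the violation needs several weights within `2⁻⁶…2⁻⁸` of `1` next to weights `1/8…1/2`; its relative size is `~3·10⁻¹⁰`.
Consequences (kernel reductions already in the tree, contraposed at the end of this file):
the hypotheses of `Consts.singleEdgeChainRule_of_edgeBernstein` (`Consts.ChainRuleEdgeBernstein`), `Consts.singleEdgeChainRule_of_dominated`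
(`Consts.DominatedChainRule`), `Consts.singleEdgeChainRule_of_chainMinor` (chain minor `≥ 0`) and `Consts.singleEdgeChainRule_of_chainRuleBernstein`
(`Consts.ChainRuleBernstein`, refuted directly in `…ChainRuleBernsteinFalse.lean`), and — via `Consts.SingleEdgeExtremal.chainRule` (weights `< 1`,
the pair `x–u` unlisted at the witness) — `Consts.SingleEdgeExtremal` and `Consts.SingleEdgeExtremalBernstein` are all false; what the counterexample does NOT touch: the RR₂/vdBHK
inequalities, `Consts.unconditionalChainRule` (`T₁ ≥ 0`), the monotonicity results for `p ≥ 0.65`, and the CSH constants themselves (rows A6/A11 of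
`CONSTANTS.md` lose this route to a proof, not their conjectured values).
[cite: VandenbergHaggstromKahn2005, Thm. 1.1 (pp. 3–5)] [cite: Grimmett1999, §2.2]
-/

namespace Summit.CriticalPhenomena.PercolationContinuityZ3.Theorems

namespace Consts

namespace CRCex

open MeasureTheory Literature.Probability.LatticeModels Literature.Probability.Percolation

/-- The witness as listed data: the pairs of `Consts.BernCex.D` with the tuned weights, cluster weight `q = 1`.
(transcription of ttrl3 relay 119 / memo g8 §8) -/
abbrev G : FK.RCEval := ⟨7, 9, ![0, 0, 0, 0, 1, 1, 2, 2, 3], ![1, 4, 5, 6, 2, 5, 3, 5, 4],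
  ![127 / 128, 1 / 4, 1 / 2, 191 / 192, 255 / 256, 63 / 64, 191 / 192, 1 / 8, 255 / 256], 1⟩

/-- The listing is valid. [folklore] -/
theorem G_valid : G.Valid := by decide +kernel

/-- Same pairs as the BERN witness: same configurations. [folklore] -/
theorem conf_eq (t : Finset (Fin 9)) : G.conf t = BernCex.D.conf t := rfl

/-! ### Cheap masses (`q = 1`: no cluster count) and the event predicates read off the level table -/

/-- `Σ_t [P t] · ∏_i (c_i or 1 − c_i)` — the mass of a predicate under the product weights (computable, no cluster count). [folklore] -/
def massW (P : Finset (Fin 9) → Bool) : ℚ := ∑ t : Finset (Fin 9), if P t then G.wQ t else 0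

/-- At `q = 1`, `massQ = massW`. [folklore] -/
theorem massQ_eq_massW (P : Finset (Fin 9) → Bool) : G.massQ P = massW P := by
  unfold FK.RCEval.massQ massW FK.RCEval.mQ
  refine Finset.sum_congr rfl fun t _ => ?_
  have hq : G.q = 1 := rfl
  rw [hq, one_pow, mul_one]

/-- At `q = 1`, `ZQ = Σ_t wQ t`. [folklore] -/
theorem zq_eq : G.ZQ = massW (fun _ => true) := by
  unfold FK.RCEval.ZQ massW FK.RCEval.mQ
  refine Finset.sum_congr rfl fun t _ => ?_
  have hq : G.q = 1 := rfl
  rw [hq, one_pow, mul_one, if_pos rfl]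

/-- The LEVEL of column `c ∈ {Y∪v, Y, Y∪o}` (number of separated sources among `x ⊂ xu ⊂ xuv`), from the kernel-checked table. [folklore] -/
def L (t : Finset (Fin 9)) (c : Fin 3) : ℕ := BernCex.levT (BernCex.maskOf t) c

/-- `R₁ = {x ↮ Y}`. -/
def pR1 (t : Finset (Fin 9)) : Bool := decide (1 ≤ L t 1)
/-- `R₂ = {xu ↮ Y}`. -/
def pR2 (t : Finset (Fin 9)) : Bool := decide (2 ≤ L t 1)
/-- `R₃ = {xuv ↮ Y}`. -/
def pR3 (t : Finset (Fin 9)) : Bool := decide (3 ≤ L t 1)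
/-- `N₁ = {x ↮ Y∪v}`. -/
def pN1 (t : Finset (Fin 9)) : Bool := decide (1 ≤ L t 0)
/-- `N₂ = {xu ↮ Y∪v}`. -/
def pN2 (t : Finset (Fin 9)) : Bool := decide (2 ≤ L t 0)
/-- `A₁ = {x ↮ Y} ∖ {x ↮ Y∪o}`. -/
def pA1 (t : Finset (Fin 9)) : Bool := decide (1 ≤ L t 1) && !decide (1 ≤ L t 2)
/-- `A₂ = {xu ↮ Y} ∖ {xu ↮ Y∪o}`. -/
def pA2 (t : Finset (Fin 9)) : Bool := decide (2 ≤ L t 1) && !decide (2 ≤ L t 2)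
/-- `A₃ = {xuv ↮ Y} ∖ {xuv ↮ Y∪o}`. -/
def pA3 (t : Finset (Fin 9)) : Bool := decide (3 ≤ L t 1) && !decide (3 ≤ L t 2)

/-! ### Kernel arithmetic (`decide +kernel`, `2⁹` configurations each: table look-ups and products of nine rationals) -/

set_option maxHeartbeats 0 in
/-- `Z = 1`. [folklore] -/
theorem massW_true : massW (fun _ => true) = 1 := by decide +kernel
set_option maxHeartbeats 0 in
/-- mass of `R₁`. (transcription of ttrl3 relay 119, re-derived by the kernel) -/
theorem mass_R1 : massW pR1 = 431445304589 / 52776558133248 := by decide +kernel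
set_option maxHeartbeats 0 in
/-- mass of `R₂`. -/
theorem mass_R2 : massW pR2 = 13803815763 / 140737488355328 := by decide +kernel
set_option maxHeartbeats 0 in
/-- mass of `R₃`. -/
theorem mass_R3 : massW pR3 = 111623239 / 1649267441664 := by decide +kernel
set_option maxHeartbeats 0 in
/-- mass of `N₁`. -/
theorem mass_N1 : massW pN1 = 10343936753087 / 1266637395197952 := by decide +kernel
set_option maxHeartbeats 0 in
/-- mass of `N₂`. -/
theorem mass_N2 : massW pN2 = 4315824213 / 140737488355328 := by decide +kernel
set_option maxHeartbeats 0 in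
/-- mass of `A₁`. -/
theorem mass_A1 : massW pA1 = 178315117 / 52776558133248 := by decide +kernel
set_option maxHeartbeats 0 in
/-- mass of `A₂`. -/
theorem mass_A2 : massW pA2 = 3756037715 / 140737488355328 := by decide +kernel
set_option maxHeartbeats 0 in
/-- mass of `A₃`. -/
theorem mass_A3 : massW pA3 = 44188487 / 1649267441664 := by decide +kernel

/-! ### From the level table to the events of the statement -/

/-- Reachability in the listed configuration as a Boolean. [folklore] -/
theorem reach_iff (t : Finset (Fin 9)) (a b : Fin 7) :
    (openGraph (G.conf t)).Reachable a b ↔ BernCex.D.reachB t a b = true := by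
  rw [conf_eq]; exact (FK.RCEval.reachB_iff (D := BernCex.D) t a b).symm

/-- The separation bits of the BERN table, column `Y∪v`: `sepB t r 0 ↔ S_r ↮ {3, 1}`. [folklore] -/
theorem sepB0_iff (t : Finset (Fin 9)) (r : Fin 3) :
    BernCex.sepB t r 0 = true ↔ ∀ s ∈ BernCex.SL r, ¬ (openGraph (G.conf t)).Reachable s 3 ∧ ¬ (openGraph (G.conf t)).Reachable s 1 := by
  simp only [BernCex.sepB, BernCex.TL, List.all_eq_true, Matrix.cons_val_zero, List.mem_cons, List.not_mem_nil,
    or_false, forall_eq_or_imp, forall_eq, Bool.not_eq_true', Bool.eq_false_iff, ne_eq]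
  exact forall₂_congr fun s _ => and_congr (not_congr (reach_iff t s 3)).symm (not_congr (reach_iff t s 1)).symm

/-- Column `Y`: `sepB t r 1 ↔ S_r ↮ {1}`. [folklore] -/
theorem sepB1_iff (t : Finset (Fin 9)) (r : Fin 3) :
    BernCex.sepB t r 1 = true ↔ ∀ s ∈ BernCex.SL r, ¬ (openGraph (G.conf t)).Reachable s 1 := by
  simp only [BernCex.sepB, BernCex.TL, List.all_eq_true, Matrix.cons_val_one, Matrix.cons_val_zero, List.mem_cons,
    List.not_mem_nil, or_false, forall_eq, Bool.not_eq_true', Bool.eq_false_iff, ne_eq]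
  exact forall₂_congr fun s _ => (not_congr (reach_iff t s 1)).symm

/-- Column `Y∪o`: `sepB t r 2 ↔ S_r ↮ {2, 1}`. [folklore] -/
theorem sepB2_iff (t : Finset (Fin 9)) (r : Fin 3) :
    BernCex.sepB t r 2 = true ↔ ∀ s ∈ BernCex.SL r, ¬ (openGraph (G.conf t)).Reachable s 2 ∧ ¬ (openGraph (G.conf t)).Reachable s 1 := by
  simp only [BernCex.sepB, BernCex.TL, List.all_eq_true, Matrix.cons_val_two, Matrix.tail_cons, Matrix.head_cons,
    List.mem_cons, List.not_mem_nil, or_false, forall_eq_or_imp, forall_eq, Bool.not_eq_true', Bool.eq_false_iff, ne_eq]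
  exact forall₂_congr fun s _ => and_congr (not_congr (reach_iff t s 2)).symm (not_congr (reach_iff t s 1)).symm

/-- **The table levels detect the separation of each source**: `i ≤ L t c ↔ sepB t (i−1) c` (monotone columns, `BernCex.table_spec`). [folklore] -/
theorem L_spec (t : Finset (Fin 9)) (c : Fin 3) :
    (1 ≤ L t c ↔ BernCex.sepB t 0 c = true) ∧ (2 ≤ L t c ↔ BernCex.sepB t 1 c = true) ∧ (3 ≤ L t c ↔ BernCex.sepB t 2 c = true) := by
  obtain ⟨h10, h21, hl⟩ := BernCex.table_spec t c
  have hL : L t c = BernCex.lv (BernCex.sepB t) c := by unfold L; exact hl.symm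
  rw [hL]
  unfold BernCex.lv
  cases h0 : BernCex.sepB t 0 c <;> cases h1 : BernCex.sepB t 1 c <;> cases h2 : BernCex.sepB t 2 c <;> simp_all

/-- The sources as lists: `SL 0 = [6]`, `SL 1 = [6,4]`, `SL 2 = [6,4,3]`. [folklore] -/
theorem SL_vals : BernCex.SL 0 = [6] ∧ BernCex.SL 1 = [6, 4] ∧ BernCex.SL 2 = [6, 4, 3] := ⟨rfl, rfl, rfl⟩

/-- `pR_i`, `pN_i`, `pA_i` in terms of the separation bits. [folklore] -/
theorem p_iff (t : Finset (Fin 9)) :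
    (pR1 t = true ↔ BernCex.sepB t 0 1 = true) ∧ (pR2 t = true ↔ BernCex.sepB t 1 1 = true) ∧ (pR3 t = true ↔ BernCex.sepB t 2 1 = true) ∧
    (pN1 t = true ↔ BernCex.sepB t 0 0 = true) ∧ (pN2 t = true ↔ BernCex.sepB t 1 0 = true) ∧
    (pA1 t = true ↔ BernCex.sepB t 0 1 = true ∧ ¬ BernCex.sepB t 0 2 = true) ∧
    (pA2 t = true ↔ BernCex.sepB t 1 1 = true ∧ ¬ BernCex.sepB t 1 2 = true) ∧
    (pA3 t = true ↔ BernCex.sepB t 2 1 = true ∧ ¬ BernCex.sepB t 2 2 = true) := by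
  have h0 := L_spec t 0; have h1 := L_spec t 1; have h2 := L_spec t 2
  simp only [pR1, pR2, pR3, pN1, pN2, pA1, pA2, pA3, Bool.and_eq_true, Bool.not_eq_true', decide_eq_true_eq,
    decide_eq_false_iff_not, h0.1, h0.2.1, h1.1, h1.2.1, h1.2.2, h2.1, h2.2.1, h2.2.2]
  tauto

/-- Membership in `R1` is the table predicate `pR1`. [folklore] -/
theorem mem_R1 (t : Finset (Fin 9)) :
    G.conf t ∈ {ω : BondConfig (Fin 7) | ∀ y ∈ ({1} : Set (Fin 7)), ¬ (openGraph ω).Reachable 6 y} ↔ pR1 t = true := by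
  rw [(p_iff t).1, sepB1_iff, SL_vals.1]
  simp only [List.mem_cons, List.not_mem_nil, or_false, forall_eq, Set.mem_setOf_eq, Set.mem_singleton_iff]

/-- Membership in `N1` is the table predicate `pN1`. [folklore] -/
theorem mem_N1 (t : Finset (Fin 9)) :
    G.conf t ∈ ({ω : BondConfig (Fin 7) | ∀ y ∈ ({1} : Set (Fin 7)), ¬ (openGraph ω).Reachable 6 y} ∩ {ω | ¬ (openGraph ω).Reachable 6 3}) ↔ pN1 t = true := by
  rw [(p_iff t).2.2.2.1, sepB0_iff, SL_vals.1]
  simp only [List.mem_cons, List.not_mem_nil, or_false, forall_eq, Set.mem_inter_iff, Set.mem_setOf_eq, Set.mem_singleton_iff]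
  tauto

/-- Membership in `A2` is the table predicate `pA2`. [folklore] -/
theorem mem_A2 (t : Finset (Fin 9)) :
    G.conf t ∈ ({ω : BondConfig (Fin 7) | ∀ y ∈ ({1} : Set (Fin 7)), ¬ (openGraph ω).Reachable 6 y ∧ ¬ (openGraph ω).Reachable 4 y} ∩ (openConn 6 2 ∪ openConn 4 2)) ↔
      pA2 t = true := by
  rw [(p_iff t).2.2.2.2.2.2.1, sepB1_iff, sepB2_iff, SL_vals.2.1]
  simp only [List.mem_cons, List.not_mem_nil, or_false, forall_eq_or_imp, forall_eq, Set.mem_inter_iff, Set.mem_union, Set.mem_setOf_eq,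
    Set.mem_singleton_iff, openConn]
  tauto

/-- Membership in `A1` is the table predicate `pA1`. [folklore] -/
theorem mem_A1 (t : Finset (Fin 9)) :
    G.conf t ∈ ({ω : BondConfig (Fin 7) | ∀ y ∈ ({1} : Set (Fin 7)), ¬ (openGraph ω).Reachable 6 y} ∩ openConn 6 2) ↔ pA1 t = true := by
  rw [(p_iff t).2.2.2.2.2.1, sepB1_iff, sepB2_iff, SL_vals.1]
  simp only [List.mem_cons, List.not_mem_nil, or_false, forall_eq, Set.mem_inter_iff,
    Set.mem_setOf_eq, Set.mem_singleton_iff, openConn]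
  tauto

/-- Membership in `R2` is the table predicate `pR2`. [folklore] -/
theorem mem_R2 (t : Finset (Fin 9)) :
    G.conf t ∈ {ω : BondConfig (Fin 7) | ∀ y ∈ ({1} : Set (Fin 7)), ¬ (openGraph ω).Reachable 6 y ∧ ¬ (openGraph ω).Reachable 4 y} ↔ pR2 t = true := by
  rw [(p_iff t).2.1, sepB1_iff, SL_vals.2.1]
  simp only [List.mem_cons, List.not_mem_nil, or_false, forall_eq_or_imp, forall_eq,
    Set.mem_setOf_eq, Set.mem_singleton_iff]

/-- Membership in `N2` is the table predicate `pN2`. [folklore] -/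
theorem mem_N2 (t : Finset (Fin 9)) :
    G.conf t ∈ ({ω : BondConfig (Fin 7) | ∀ y ∈ ({1} : Set (Fin 7)), ¬ (openGraph ω).Reachable 6 y ∧ ¬ (openGraph ω).Reachable 4 y} ∩
        {ω | ¬ (openGraph ω).Reachable 6 3 ∧ ¬ (openGraph ω).Reachable 4 3}) ↔
      pN2 t = true := by
  rw [(p_iff t).2.2.2.2.1, sepB0_iff, SL_vals.2.1]
  simp only [List.mem_cons, List.not_mem_nil, or_false, forall_eq_or_imp, forall_eq, Set.mem_inter_iff,
    Set.mem_setOf_eq, Set.mem_singleton_iff]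
  tauto

/-- Membership in `R3` is the table predicate `pR3`. [folklore] -/
theorem mem_R3 (t : Finset (Fin 9)) :
    G.conf t ∈ {ω : BondConfig (Fin 7) | ∀ y ∈ ({1} : Set (Fin 7)), ¬ (openGraph ω).Reachable 6 y ∧ ¬ (openGraph ω).Reachable 4 y ∧ ¬ (openGraph ω).Reachable 3 y} ↔
      pR3 t = true := by
  rw [(p_iff t).2.2.1, sepB1_iff, SL_vals.2.2]
  simp only [List.mem_cons, List.not_mem_nil, or_false, forall_eq_or_imp, forall_eq,
    Set.mem_setOf_eq, Set.mem_singleton_iff]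

/-- Membership in `A3` is the table predicate `pA3`. [folklore] -/
theorem mem_A3 (t : Finset (Fin 9)) :
    G.conf t ∈ ({ω : BondConfig (Fin 7) | ∀ y ∈ ({1} : Set (Fin 7)), ¬ (openGraph ω).Reachable 6 y ∧ ¬ (openGraph ω).Reachable 4 y ∧ ¬ (openGraph ω).Reachable 3 y} ∩
        (openConn 6 2 ∪ openConn 4 2 ∪ openConn 3 2)) ↔
      pA3 t = true := by
  rw [(p_iff t).2.2.2.2.2.2.2, sepB1_iff, sepB2_iff, SL_vals.2.2]
  simp only [List.mem_cons, List.not_mem_nil, or_false, forall_eq_or_imp, forall_eq, Set.mem_inter_iff, Set.mem_union,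
    Set.mem_setOf_eq, Set.mem_singleton_iff, openConn]
  tauto

/-! ### The eight measures as real numbers, and the refutation -/

/-- At `q = 1` the random-cluster measure of the listing is the Bernoulli product measure. [cite: Grimmett2006, §1.3] -/
theorem rc_eq : rcMeasureW G.w ((G.q : ℚ) : ℝ) ∅ = prodBernoulli G.w := by
  have : ((G.q : ℚ) : ℝ) = 1 := by norm_num [G]
  rw [this]; exact rcMeasureW_one G.w ∅

/-- `μ(R1)` at the witness, exactly. -/
theorem real_R1 :
    (prodBernoulli G.w).real {ω : BondConfig (Fin 7) | ∀ y ∈ ({1} : Set (Fin 7)), ¬ (openGraph ω).Reachable 6 y} =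
      ((431445304589 / 52776558133248 : ℚ) : ℝ) := by
  have h := FK.RCEval.real_eq_massQ_div G_valid (mem_R1)
  rw [rc_eq, massQ_eq_massW, mass_R1, zq_eq, massW_true, div_one] at h
  exact h

/-- `μ(N1)` at the witness, exactly. -/
theorem real_N1 :
    (prodBernoulli G.w).real ({ω : BondConfig (Fin 7) | ∀ y ∈ ({1} : Set (Fin 7)), ¬ (openGraph ω).Reachable 6 y} ∩ {ω | ¬ (openGraph ω).Reachable 6 3}) =
      ((10343936753087 / 1266637395197952 : ℚ) : ℝ) := by
  have h := FK.RCEval.real_eq_massQ_div G_valid (mem_N1)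
  rw [rc_eq, massQ_eq_massW, mass_N1, zq_eq, massW_true, div_one] at h
  exact h

/-- `μ(A1)` at the witness, exactly. -/
theorem real_A1 :
    (prodBernoulli G.w).real ({ω : BondConfig (Fin 7) | ∀ y ∈ ({1} : Set (Fin 7)), ¬ (openGraph ω).Reachable 6 y} ∩ openConn 6 2) =
      ((178315117 / 52776558133248 : ℚ) : ℝ) := by
  have h := FK.RCEval.real_eq_massQ_div G_valid (mem_A1)
  rw [rc_eq, massQ_eq_massW, mass_A1, zq_eq, massW_true, div_one] at h
  exact h

/-- `μ(R2)` at the witness, exactly. -/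
theorem real_R2 :
    (prodBernoulli G.w).real {ω : BondConfig (Fin 7) | ∀ y ∈ ({1} : Set (Fin 7)), ¬ (openGraph ω).Reachable 6 y ∧ ¬ (openGraph ω).Reachable 4 y} =
      ((13803815763 / 140737488355328 : ℚ) : ℝ) := by
  have h := FK.RCEval.real_eq_massQ_div G_valid (mem_R2)
  rw [rc_eq, massQ_eq_massW, mass_R2, zq_eq, massW_true, div_one] at h
  exact h

/-- `μ(A2)` at the witness, exactly. -/
theorem real_A2 :
    (prodBernoulli G.w).real ({ω : BondConfig (Fin 7) | ∀ y ∈ ({1} : Set (Fin 7)), ¬ (openGraph ω).Reachable 6 y ∧ ¬ (openGraph ω).Reachable 4 y} ∩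
        (openConn 6 2 ∪ openConn 4 2)) =
      ((3756037715 / 140737488355328 : ℚ) : ℝ) := by
  have h := FK.RCEval.real_eq_massQ_div G_valid (mem_A2)
  rw [rc_eq, massQ_eq_massW, mass_A2, zq_eq, massW_true, div_one] at h
  exact h

/-- `μ(N2)` at the witness, exactly. -/
theorem real_N2 :
    (prodBernoulli G.w).real ({ω : BondConfig (Fin 7) | ∀ y ∈ ({1} : Set (Fin 7)), ¬ (openGraph ω).Reachable 6 y ∧ ¬ (openGraph ω).Reachable 4 y} ∩
        {ω | ¬ (openGraph ω).Reachable 6 3 ∧ ¬ (openGraph ω).Reachable 4 3}) =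
      ((4315824213 / 140737488355328 : ℚ) : ℝ) := by
  have h := FK.RCEval.real_eq_massQ_div G_valid (mem_N2)
  rw [rc_eq, massQ_eq_massW, mass_N2, zq_eq, massW_true, div_one] at h
  exact h

/-- `μ(R3)` at the witness, exactly. -/
theorem real_R3 :
    (prodBernoulli G.w).real {ω : BondConfig (Fin 7) | ∀ y ∈ ({1} : Set (Fin 7)), ¬ (openGraph ω).Reachable 6 y ∧ ¬ (openGraph ω).Reachable 4 y ∧ ¬ (openGraph ω).Reachable 3 y} =
      ((111623239 / 1649267441664 : ℚ) : ℝ) := by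
  have h := FK.RCEval.real_eq_massQ_div G_valid (mem_R3)
  rw [rc_eq, massQ_eq_massW, mass_R3, zq_eq, massW_true, div_one] at h
  exact h

/-- `μ(A3)` at the witness, exactly. -/
theorem real_A3 :
    (prodBernoulli G.w).real ({ω : BondConfig (Fin 7) | ∀ y ∈ ({1} : Set (Fin 7)), ¬ (openGraph ω).Reachable 6 y ∧ ¬ (openGraph ω).Reachable 4 y ∧ ¬ (openGraph ω).Reachable 3 y} ∩
        (openConn 6 2 ∪ openConn 4 2 ∪ openConn 3 2)) =
      ((44188487 / 1649267441664 : ℚ) : ℝ) := by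
  have h := FK.RCEval.real_eq_massQ_div G_valid (mem_A3)
  rw [rc_eq, massQ_eq_massW, mass_A3, zq_eq, massW_true, div_one] at h
  exact h

/-- All weights of the witness are `< 1` (the largest is `255/256`). [folklore] -/
theorem w_lt_one (d : Sym2 (Fin 7)) : G.w d < 1 := by
  refine unitInterval.coe_lt_one.1 ?_
  by_cases hd : d ∈ Set.range G.edge
  · obtain ⟨i, rfl⟩ := hd
    rw [FK.RCEval.w_edge G_valid i]
    exact_mod_cast (by decide +kernel : ∀ i : Fin 9, G.c i < 1) i
  · rw [FK.RCEval.w_eq_zero_of_notMem_range hd]; norm_num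

/-- The pair `x–u = s(6,4)` is not listed, so switching it off does not change the weights. [folklore] -/
theorem w_pairOpen_eq : (fun d => if d = s((6 : Fin 7), 4) then (0 : unitInterval) else G.w d) = G.w := by
  funext d
  split_ifs with h
  · subst h
    have h64 : s((6 : Fin 7), 4) ∉ Set.range G.edge := by
      rintro ⟨i, hi⟩; exact absurd hi (by revert i; decide)
    exact (Subtype.ext (FK.RCEval.w_eq_zero_of_notMem_range h64)).symm
  · rfl

/-- **The chain-rule inequality FAILS at the witness instance** (`x = 6, u = 4, v = 3, o = 2, Y = {1}`); exposed at instance level so that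
every typed statement implying the chain rule instance-wise is refuted by a one-liner. -/
theorem instance_fails : ¬ (
    (prodBernoulli G.w).real ({ω : BondConfig (Fin 7) | ∀ y ∈ ({1} : Set (Fin 7)), ¬ (openGraph ω).Reachable 6 y} ∩
        {ω | ¬ (openGraph ω).Reachable 6 3}) *
      ((prodBernoulli G.w).real ({ω : BondConfig (Fin 7) | ∀ y ∈ ({1} : Set (Fin 7)), ¬ (openGraph ω).Reachable 6 y ∧
          ¬ (openGraph ω).Reachable 4 y ∧ ¬ (openGraph ω).Reachable 3 y} ∩ (openConn 6 2 ∪ openConn 4 2 ∪ openConn 3 2)) *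
        (prodBernoulli G.w).real {ω : BondConfig (Fin 7) | ∀ y ∈ ({1} : Set (Fin 7)), ¬ (openGraph ω).Reachable 6 y ∧
          ¬ (openGraph ω).Reachable 4 y} -
      (prodBernoulli G.w).real ({ω : BondConfig (Fin 7) | ∀ y ∈ ({1} : Set (Fin 7)), ¬ (openGraph ω).Reachable 6 y ∧
          ¬ (openGraph ω).Reachable 4 y} ∩ (openConn 6 2 ∪ openConn 4 2)) *
        (prodBernoulli G.w).real {ω : BondConfig (Fin 7) | ∀ y ∈ ({1} : Set (Fin 7)), ¬ (openGraph ω).Reachable 6 y ∧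
          ¬ (openGraph ω).Reachable 4 y ∧ ¬ (openGraph ω).Reachable 3 y}) ≤
    (prodBernoulli G.w).real ({ω : BondConfig (Fin 7) | ∀ y ∈ ({1} : Set (Fin 7)), ¬ (openGraph ω).Reachable 6 y ∧
          ¬ (openGraph ω).Reachable 4 y} ∩ {ω | ¬ (openGraph ω).Reachable 6 3 ∧ ¬ (openGraph ω).Reachable 4 3}) *
      ((prodBernoulli G.w).real ({ω : BondConfig (Fin 7) | ∀ y ∈ ({1} : Set (Fin 7)), ¬ (openGraph ω).Reachable 6 y ∧
          ¬ (openGraph ω).Reachable 4 y ∧ ¬ (openGraph ω).Reachable 3 y} ∩ (openConn 6 2 ∪ openConn 4 2 ∪ openConn 3 2)) *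
        (prodBernoulli G.w).real {ω : BondConfig (Fin 7) | ∀ y ∈ ({1} : Set (Fin 7)), ¬ (openGraph ω).Reachable 6 y} -
      (prodBernoulli G.w).real ({ω : BondConfig (Fin 7) | ∀ y ∈ ({1} : Set (Fin 7)), ¬ (openGraph ω).Reachable 6 y} ∩ openConn 6 2) *
        (prodBernoulli G.w).real {ω : BondConfig (Fin 7) | ∀ y ∈ ({1} : Set (Fin 7)), ¬ (openGraph ω).Reachable 6 y ∧
          ¬ (openGraph ω).Reachable 4 y ∧ ¬ (openGraph ω).Reachable 3 y})) := by
  rw [real_N1, real_A3, real_R2, real_A2, real_R3, real_N2, real_R1, real_A1]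
  norm_num

end CRCex

/-- **THEOREM: the single-edge chain rule `Consts.SingleEdgeChainRule` is FALSE.**  At the witness (`n = 7`, `x = 6`, `u = 4`, `v = 3`,
`o = 2`, `Y = {1}`), `RHS − LHS = −18640298111694042707/1148452988358167314188889300082217713664 < 0`.
[cite: VandenbergHaggstromKahn2005, Thm. 1.1 (pp. 3–5)] -/
theorem not_singleEdgeChainRule : ¬ SingleEdgeChainRule :=
  fun h => CRCex.instance_fails (h 7 CRCex.G.w 6 4 3 2 ({1} : Set (Fin 7)))

/-- **COROLLARY: the edge-Bernstein conjecture `Consts.ChainRuleEdgeBernstein` is FALSE** — it implies the chain rule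
(`Consts.singleEdgeChainRule_of_edgeBernstein`). [cite: VandenbergHaggstromKahn2005, Thm. 1.1 (pp. 3–5)] -/
theorem not_chainRuleEdgeBernstein : ¬ ChainRuleEdgeBernstein :=
  fun h => not_singleEdgeChainRule (singleEdgeChainRule_of_edgeBernstein h)

/-- **COROLLARY: the dominated chain rule `Consts.DominatedChainRule` is FALSE** — it implies the chain rule
(`Consts.singleEdgeChainRule_of_dominated`). [cite: VandenbergHaggstromKahn2005, Thm. 1.1 (pp. 3–5)] -/
theorem not_dominatedChainRule : ¬ DominatedChainRule :=
  fun h => not_singleEdgeChainRule (singleEdgeChainRule_of_dominated h)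

/-- **COROLLARY: the single-edge extremal conjecture `Consts.SingleEdgeExtremal` is FALSE** — for weights `< 1`, `x ≠ u`, `x ∉ Y` it gives the
chain rule for the law with the pair `x–u` switched off (`Consts.SingleEdgeExtremal.chainRule`); at the witness that pair is unlisted, so the law is
unchanged. [cite: VandenbergHaggstromKahn2005, Thm. 1.1 (pp. 3–5)] -/
theorem not_singleEdgeExtremal : ¬ SingleEdgeExtremal := by
  intro hS
  have h := hS.chainRule CRCex.G.w CRCex.w_lt_one 6 4 3 2 ({1} : Set (Fin 7)) (by decide) (by simp)
  rw [CRCex.w_pairOpen_eq] at h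
  exact CRCex.instance_fails h

/-- **COROLLARY: `Consts.SingleEdgeExtremalBernstein` is FALSE** (`Consts.singleEdgeExtremal_of_bernstein`).
[cite: VandenbergHaggstromKahn2005, Thm. 1.1 (pp. 3–5)] -/
theorem not_singleEdgeExtremalBernstein : ¬ SingleEdgeExtremalBernstein :=
  fun h => not_singleEdgeExtremal (singleEdgeExtremal_of_bernstein h)

end Consts

end Summit.CriticalPhenomena.PercolationContinuityZ3.Theorems
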